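import Summits.Ventures.QEC.Theorems.BB90DistanceCertificateTarget
import Summits.Ventures.QEC.Decoders.BBOptimalRadius
import HarnessLib

/-!
# `[[90,8,10]]` (`BB.bb90 = QC(x⁹+y+y², 1+x²+x⁷)` on `ℤ_15 × ℤ_3`): correction radius `4` is OPTIMAL and ATTAINED — the Q4
# «theorem column» of this bivariate-bicycle row, read off the certified claim (route BB90DistanceCertificate)

HONEST FRAMING: CERTIFIED column, tier KERNEL-std (pure corollaries of `BB90_8_10_claim_holds`, p481171 — KERNEL-std;
no `decide` beyond `0 < 10`; axioms ⊆ {propext, Classical.choice, Quot.sound}). For the TYPED code `BB.bb90.css`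
(qubits `Mono 15 3 ⊕ Mono 15 3`) and its flat form `BB.bb90.cssFlat` (qubits `Fin 90`), via
`Decoders/BBOptimalRadius.lean` (`HasParams C n k d ∧ 0 < d ⇒ optimal radius ⌊(d−1)/2⌋`):
* `bb90_optimalRadiusX` / `bb90_optimalRadiusZ` — some `X`- (resp. `Z`-) decoder, namely minimum-weight decoding, has
  correction radius EXACTLY `4 = ⌊(10−1)/2⌋`, and NO decoder of that sector — no function of the syndrome whatsoever —
  corrects every error of weight `≤ 5` (Gottesman 1997 §2.3; Delfosse–Nickerson §3 «tight»);
* `bb90_optimalRadius_cssFlat` — at the Pauli level: some Pauli decoder has radius exactly `4` in symplectic weight and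
  NO Pauli decoder, sector-wise or not, corrects more.
Explicit decoder TABLES are a different (kernel-table) lane and are not feasible at `t = 4`, `n = 90`; search-6's BP+OSD artifact rows for BB108 are COMPUTED-exhaustive
(cert/radius/INDEX.tsv) — this file is the THEOREM row. Nothing probabilistic. LEAF file (imports the route's Target closer).
-/

namespace Summit.Ventures.QEC.BB

open Literature.InformationTheory.QuantumCodes Literature.InformationTheory.QuantumCodes.BB
  Summit.Ventures.QEC.Census.BB90

/-- **`[[90,8,10]]`, typed code, `X`-sector**: some `X`-decoder of `BB.bb90.css` has correction radius EXACTLY `4`, and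
no `X`-decoder corrects every `X`-error of weight `≤ 5`. [cite: Gottesman1997, §2.3 (chunk p0014 L3)] -/
theorem bb90_optimalRadiusX :
    (∃ D : Decoder (Mono 15 3 → ZMod 2) (Mono 15 3 ⊕ Mono 15 3 → ZMod 2),
        D.IsCorrectionRadius BB.bb90.css.xSyndrome (BB.bb90.css.rowSpX : Set (Mono 15 3 ⊕ Mono 15 3 → ZMod 2))
          hammingNorm 4) ∧
      ∀ (D : Decoder (Mono 15 3 → ZMod 2) (Mono 15 3 ⊕ Mono 15 3 → ZMod 2)) (t : ℕ),
        D.CorrectsUpTo BB.bb90.css.xSyndrome (BB.bb90.css.rowSpX : Set (Mono 15 3 ⊕ Mono 15 3 → ZMod 2)) hammingNorm t →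
          t ≤ 4 :=
  optimalRadiusX_of_hasParams BB90_8_10_claim_holds (by decide)

/-- **`[[90,8,10]]`, typed code, `Z`-sector**: radius EXACTLY `4` attained, no `Z`-decoder corrects 5 errors.
[cite: Gottesman1997, §2.3 (chunk p0014 L3)] -/
theorem bb90_optimalRadiusZ :
    (∃ D : Decoder (Mono 15 3 → ZMod 2) (Mono 15 3 ⊕ Mono 15 3 → ZMod 2),
        D.IsCorrectionRadius BB.bb90.css.zSyndrome (BB.bb90.css.rowSpZ : Set (Mono 15 3 ⊕ Mono 15 3 → ZMod 2))
          hammingNorm 4) ∧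
      ∀ (D : Decoder (Mono 15 3 → ZMod 2) (Mono 15 3 ⊕ Mono 15 3 → ZMod 2)) (t : ℕ),
        D.CorrectsUpTo BB.bb90.css.zSyndrome (BB.bb90.css.rowSpZ : Set (Mono 15 3 ⊕ Mono 15 3 → ZMod 2)) hammingNorm t →
          t ≤ 4 :=
  optimalRadiusZ_of_hasParams BB90_8_10_claim_holds (by decide)

/-- **`[[90,8,10]]`, flat code `BB.bb90.cssFlat` (qubits `Fin 90`), Pauli level**: some Pauli decoder has correction
radius EXACTLY `4` in symplectic weight and NO Pauli decoder, sector-wise or not, corrects every Pauli error of weight `≤ 5`.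
[cite: Gottesman1997, §2.3 (chunk p0014 L3)] [cite: DelfosseNickerson2021, §3 ¶2 (chunk p0006 L8–13)] -/
theorem bb90_optimalRadius_cssFlat :
    (∃ D : Decoder ((Fin (15 * 3) → ZMod 2) × (Fin (15 * 3) → ZMod 2)) (SympVec (15 * 3 + 15 * 3)),
        D.IsCorrectionRadius (cssSyndrome BB.bb90.cssFlat.xSyndrome BB.bb90.cssFlat.zSyndrome)
          (BB.bb90.cssFlat.toSympCode : Set (SympVec (15 * 3 + 15 * 3))) sympWeight 4) ∧
      ∀ (D : Decoder ((Fin (15 * 3) → ZMod 2) × (Fin (15 * 3) → ZMod 2)) (SympVec (15 * 3 + 15 * 3))) (t : ℕ),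
        D.CorrectsUpTo (cssSyndrome BB.bb90.cssFlat.xSyndrome BB.bb90.cssFlat.zSyndrome)
          (BB.bb90.cssFlat.toSympCode : Set (SympVec (15 * 3 + 15 * 3))) sympWeight t → t ≤ 4 :=
  optimalRadius_cssFlat_of_hasParams BB90_8_10_claim_holds (by decide)

end Summit.Ventures.QEC.BB
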